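import Summits.AtomisticToContinuum.Crystallization.Theorems.PricedLinkCensusLocalToGlobalPhaseGapDefs

/-!
# Crux `LocalToGlobal` (stmt-AtomisticToContinuum-14232), line `phase-gap-rate-upgrade`:
# the route target `ZeroChargeBulk` from the qualitative phase gap Sub₁ alone

The route target `ZeroChargeBulk` of `PricedLinkCensus` (the charged fraction of Lennard-Jones ground states in `ℝ³`
tends to `0` at tolerance `1/100`) follows from the QUALITATIVE phase gap `QualitativeChargeGapWith (1/100)` (Sub₁ of
the line; no rate in `ρ`, no boundary term) through the unconditional energy limit
`crysEnergyLimit : E(N)/N → e*` (`Theorems/ChargedEnergyGap/Negative/Unconditional.lean`): given `ρ > 0`, Sub₁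
provides `g > 0` with `N (e* + g) ≤ E_LJ(y)` whenever `#ch(y) ≥ ρ N`; since `E(N)/N < e* + g` for large `N`, a ground
state of `N` particles has `#ch < ρ N` eventually, i.e. `0 ≤ #ch/N < ρ` eventually
(`zeroChargeBulk_of_qualitativeChargeGap`, the registered stub of the line).  The periodic form
`zeroChargeBulk_of_periodicPhaseGap` composes with `qualitativeChargeGap_of_periodicPhaseGap`.  All `[folklore]`
(ε–N bookkeeping over landed facts).
-/

noncomputable section

namespace Summit.AtomisticToContinuum.Crystallization.Theorems.PricedLinkCensusLocalToGlobalPhaseGap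

open Literature.MathematicalPhysics.StatisticalMechanics
open Literature.Geometry.DiscreteGeometry
open Summit.AtomisticToContinuum.Crystallization.Theses.PricedLinkCensus
open Summit.AtomisticToContinuum.Crystallization.Theorems.ChargedEnergyGapNegative
open Filter Topology

/-- The energy limit over `eStar`: `E(N)/N → e*` (`crysEnergyLimit`, restated with the abbreviation). [folklore] -/
theorem tendsto_groundStateEnergy_div_eStar :
    Tendsto (fun N : ℕ => groundStateEnergy lennardJones 3 N / N) atTop (𝓝 eStar) :=
  crysEnergyLimit

/-- **Ground states are eventually `ρ`-sparse under the phase gap.**  If `PhaseGapWith η ρ g` holds with `g > 0`, then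
along any sequence of Lennard-Jones ground states `x N` the number of sites not charge-free at tolerance `η` is
eventually `< ρ N`: otherwise `N (e* + g) ≤ E(N)`, contradicting `E(N)/N → e*`. [folklore] -/
theorem eventually_charged_lt_of_phaseGapWith {η ρ g : ℝ} (hg : 0 < g) (hP : PhaseGapWith η ρ g)
    (x : (N : ℕ) → (Fin N → E3)) (hx : ∀ N, IsGroundState lennardJones (x N)) :
    ∀ᶠ N : ℕ in atTop, (charged η (x N) : ℝ) < ρ * N := by
  have hlt : eStar < eStar + g := by linarith
  filter_upwards [tendsto_groundStateEnergy_div_eStar.eventually_lt_const hlt, eventually_gt_atTop 0] with N hN hN0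
  have hNr : (0 : ℝ) < N := by exact_mod_cast hN0
  rw [div_lt_iff₀ hNr] at hN
  by_contra hcon
  push Not at hcon
  have h1 := hP N (x N) (hx N).1 hcon
  have h2 : interactionEnergy lennardJones (x N) = groundStateEnergy lennardJones 3 N := (hx N).2
  linarith

/-- **Eventual sparseness from Sub₁**: under `QualitativeChargeGapWith η`, for every `ρ > 0` a sequence of
Lennard-Jones ground states has eventually fewer than `ρ N` sites not charge-free at tolerance `η`. [folklore] -/
theorem eventually_charged_lt_of_qualitativeChargeGap {η : ℝ} (h : QualitativeChargeGapWith η) {ρ : ℝ}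
    (hρ : 0 < ρ) (x : (N : ℕ) → (Fin N → E3)) (hx : ∀ N, IsGroundState lennardJones (x N)) :
    ∀ᶠ N : ℕ in atTop, (charged η (x N) : ℝ) < ρ * N := by
  rw [qualitativeChargeGapWith_iff] at h
  obtain ⟨g, hg, hP⟩ := h ρ hρ
  exact eventually_charged_lt_of_phaseGapWith hg hP x hx

/-- **The charged fraction of ground states tends to `0` under Sub₁** (any tolerance `η`). [folklore] -/
theorem tendsto_chargedFraction_of_qualitativeChargeGap {η : ℝ} (h : QualitativeChargeGapWith η)
    (x : (N : ℕ) → (Fin N → E3)) (hx : ∀ N, IsGroundState lennardJones (x N)) :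
    Tendsto (fun N : ℕ => (charged η (x N) : ℝ) / N) atTop (𝓝 0) := by
  rw [Metric.tendsto_nhds]
  intro ε hε
  filter_upwards [eventually_charged_lt_of_qualitativeChargeGap h hε x hx, eventually_gt_atTop 0] with N hN hN0
  have hNr : (0 : ℝ) < N := by exact_mod_cast hN0
  rw [Real.dist_0_eq_abs, abs_of_nonneg (div_nonneg (Nat.cast_nonneg _) hNr.le), div_lt_iff₀ hNr]
  exact hN

/-- **The route target from Sub₁ alone** (registered stub `zeroChargeBulk_of_qualitativeChargeGap` of line
`phase-gap-rate-upgrade`, crux stmt-AtomisticToContinuum-14232): the qualitative phase gap at tolerance `1/100`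
implies `ZeroChargeBulk` — in Lennard-Jones ground states in `ℝ³` the fraction of sites not charge-free at tolerance
`1/100` tends to `0`.  Proof: `tendsto_chargedFraction_of_qualitativeChargeGap` (ε–N through `crysEnergyLimit`).
[folklore] -/
theorem zeroChargeBulk_of_qualitativeChargeGap : QualitativeChargeGapWith (1 / 100) → ZeroChargeBulk :=
  fun h x hx => tendsto_chargedFraction_of_qualitativeChargeGap h x hx

/-- **The route target from the PERIODIC phase gap** (the form the line's open stub feeds): compose
`qualitativeChargeGap_of_periodicPhaseGap` (`1/100 ≤ 1`) with `zeroChargeBulk_of_qualitativeChargeGap`. [folklore] -/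
theorem zeroChargeBulk_of_periodicPhaseGap : PeriodicPhaseGapWith (1 / 100) → ZeroChargeBulk :=
  fun h => zeroChargeBulk_of_qualitativeChargeGap (qualitativeChargeGap_of_periodicPhaseGap (by norm_num) h)

end Summit.AtomisticToContinuum.Crystallization.Theorems.PricedLinkCensusLocalToGlobalPhaseGap

end
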